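import Mathlib
import Literature.Barriers.Schanuel.LargeTranscendenceDegreeHolds
import Literature.Barriers.Schanuel.LargeTranscendenceDegreeProofs
import Summits.Schanuel.Schanuel.Theorems.RigidCoreSchanuelOnLogFreeCorePiRealPowersTH

/-!
# Diaz's Theorem 2.7 on the grid of real powers of `π` (stub `stub_piRealGridBound`, C15)

Registered stub `stub_piRealGridBound` (calibration C15) of line `sector-split` of crux
`stmt-Schanuel-0970` (`Summit.Schanuel.Schanuel.Theses.RigidCore.SchanuelOnLogFreeCore`).  This is
an off-path CALIBRATION of the crux: Diaz's Theorem 2.7, clause `t₂` (Yu. V. Nesterenko,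
P. Philippon (eds.), LNM 1752, Ch. 14, Theorem 2.7; PROVED in the tree as
`Literature.Barriers.Schanuel.ceil_le_trdeg_gridField₂`) on the grid `x = (πⁱ)_{i<d}`,
`y = (πʲ)_{j<ℓ}` of REAL powers of `π`, taking the Technical Hypothesis (loc. cit., Definition 2.6)
for the power tuples `(1, π, …, π^{d-1})` as an explicit HYPOTHESIS (it is the sibling stub
`stub_piRealPowersTH`, C14).  We prove:

* `PiRealGrid.gridField₂_le_explicit` — the grid field `gridField₂ x y = ℚ(πⁱ, πʲ, e^{π^{i+j}})`
  lies in the explicit field `ℚ(π, e^{π^k} : k < d + ℓ − 1)`;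
* `PiRealGrid.ceil_le_trdeg_gridField₂_pi_pow` — under (T.H.) for the power tuples and
  `ℓ + d < dℓ`, `⌈dℓ/(ℓ+d)⌉ ≤ trdeg_ℚ (gridField₂ x y)`; the linear independence of
  `1, π, …, π^{n-1}` (Lindemann) is the landed `PiRealPowersTH.linearIndependent_pi_pow` of the
  sibling calibration file `…PiRealPowersTH.lean` (C14), whose `stub_piRealPowersTH` is NOT used
  here (it stays the hypothesis of the registered signature);
* `stub_piRealGridBound` (signature verbatim) — the same bound for the explicit field
  `ℚ(π, e^{π^k} : k < d + ℓ − 1)`, by monotonicity of the transcendence degree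
  (`Literature.Barriers.Schanuel.trdeg_mono`);
* `PiRealGrid.three_le_trdeg_pi_exp_pow_eight` — the instance `(d, ℓ) = (4, 5)`:
  `3 ≤ trdeg_ℚ ℚ(π, e, e^π, e^{π²}, …, e^{π⁷})`.

No definition is introduced; auxiliaries live in the sub-namespace `…RigidCore.PiRealGrid`, only
the registered stub is declared directly in `Summit.Schanuel.Schanuel.Theorems.RigidCore`.

## References

* Yu. V. Nesterenko, P. Philippon (eds.), *Introduction to Algebraic Independence Theory*,
  LNM 1752, Springer (2001), Ch. 14, Definition 2.6 and Theorem 2.7. [NesterenkoPhilippon2001]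
* F. Lindemann, *Über die Zahl `π`*, Math. Ann. 20 (1882), 213–225. [Lindemann1882]
-/

noncomputable section

namespace Summit.Schanuel.Schanuel.Theorems.RigidCore

namespace PiRealGrid

/-- The grid field `gridField₂ x y` of the real `π`-power grid `x = (πⁱ)_{i<d}`, `y = (πʲ)_{j<ℓ}`
is contained in the explicit field `ℚ(π, e^{π^k} : k < d + ℓ − 1)`: its generators are the `πⁱ`,
the `πʲ` (powers of `π`) and the `e^{πⁱ πʲ} = e^{π^{i+j}}` with `i + j ≤ d + ℓ − 2`. [folklore] -/
theorem gridField₂_le_explicit (d l : ℕ) :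
    Literature.Barriers.Schanuel.gridField₂
        (fun i : Fin d => (Real.pi : ℂ) ^ (i : ℕ)) (fun j : Fin l => (Real.pi : ℂ) ^ (j : ℕ)) ≤
      IntermediateField.adjoin ℚ ({(Real.pi : ℂ)} ∪
        Set.range (fun k : Fin (d + l - 1) => Complex.exp ((Real.pi : ℂ) ^ (k : ℕ)))) := by
  have hπ : (Real.pi : ℂ) ∈ IntermediateField.adjoin ℚ ({(Real.pi : ℂ)} ∪
      Set.range (fun k : Fin (d + l - 1) => Complex.exp ((Real.pi : ℂ) ^ (k : ℕ)))) :=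
    IntermediateField.subset_adjoin _ _ (Set.mem_union_left _ rfl)
  rw [Literature.Barriers.Schanuel.gridField₂]
  refine IntermediateField.adjoin_le_iff.mpr ?_
  rintro z ((⟨i, rfl⟩ | ⟨i, rfl⟩) | ⟨p, rfl⟩)
  · exact pow_mem hπ _
  · exact pow_mem hπ _
  · have hlt : (p.1 : ℕ) + (p.2 : ℕ) < d + l - 1 := by
      have h1 := p.1.is_lt; have h2 := p.2.is_lt; omega
    refine IntermediateField.subset_adjoin _ _ (Set.mem_union_right _ ⟨⟨_, hlt⟩, ?_⟩)
    simp [pow_add]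

/-- **Diaz's Theorem 2.7, clause `t₂`, on the real `π`-power grid** (Nesterenko–Philippon (eds.),
LNM 1752, Ch. 14, Theorem 2.7; PROVED in the tree as `ceil_le_trdeg_gridField₂`): if the power
tuples `(1, π, …, π^{n-1})` satisfy the Technical Hypothesis (Definition 2.6) for every `n`, then
for `ℓ + d < dℓ`, `⌈dℓ/(ℓ+d)⌉ ≤ trdeg_ℚ ℚ(πⁱ, πʲ, e^{π^{i+j}})`.  The linear independence inputs
are Lindemann's theorem (`PiRealPowersTH.linearIndependent_pi_pow`).
[cite: NesterenkoPhilippon2001, Ch. 14 Thm 2.7] -/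
theorem ceil_le_trdeg_gridField₂_pi_pow
    (hTH : ∀ d : ℕ, Literature.Barriers.Schanuel.TechnicalHypothesis
      (fun i : Fin d => (Real.pi : ℂ) ^ (i : ℕ)))
    {d l : ℕ} (hdl : l + d < d * l) :
    ((⌈((d * l : ℕ) : ℚ) / ((l + d : ℕ) : ℚ)⌉₊ : ℕ) : Cardinal) ≤
      Algebra.trdeg ℚ ↥(Literature.Barriers.Schanuel.gridField₂
        (fun i : Fin d => (Real.pi : ℂ) ^ (i : ℕ)) (fun j : Fin l => (Real.pi : ℂ) ^ (j : ℕ))) :=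
  Literature.Barriers.Schanuel.ceil_le_trdeg_gridField₂ _ _
    (PiRealPowersTH.linearIndependent_pi_pow d) (hTH d)
    (PiRealPowersTH.linearIndependent_pi_pow l) (hTH l) hdl

end PiRealGrid

/-! ## The registered stub -/

/-- **Registered stub `stub_piRealGridBound` (C15) of line `sector-split`** (signature verbatim):
Diaz's Theorem 2.7, clause `t₂` (Nesterenko–Philippon (eds.), LNM 1752, Ch. 14, Theorem 2.7;
PROVED in the tree as `Literature.Barriers.Schanuel.ceil_le_trdeg_gridField₂`) on the grid
`x = (πⁱ)_{i<d}`, `y = (πʲ)_{j<ℓ}`, under the Technical Hypothesis for the real power tuples of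
`π` (the sibling stub `stub_piRealPowersTH`, taken here as a hypothesis): for `ℓ + d < dℓ`,
`⌈dℓ/(ℓ+d)⌉ ≤ trdeg_ℚ ℚ(π, e^{π^k} : k < d + ℓ − 1)`.  Proof:
`PiRealGrid.ceil_le_trdeg_gridField₂_pi_pow` transported along
`gridField₂ x y ≤ ℚ(π, e^{π^k} : k < d + ℓ − 1)` (`PiRealGrid.gridField₂_le_explicit`) by
monotonicity of the transcendence degree (`Literature.Barriers.Schanuel.trdeg_mono`).
[cite: NesterenkoPhilippon2001, Ch. 14 Thm 2.7] -/
theorem stub_piRealGridBound :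
    (∀ d : ℕ, Literature.Barriers.Schanuel.TechnicalHypothesis
      (fun i : Fin d => (Real.pi : ℂ) ^ (i : ℕ))) →
    ∀ d l : ℕ, l + d < d * l →
      ((⌈((d * l : ℕ) : ℚ) / ((l + d : ℕ) : ℚ)⌉₊ : ℕ) : Cardinal) ≤
        Algebra.trdeg ℚ ↥(IntermediateField.adjoin ℚ
          ({(Real.pi : ℂ)} ∪ Set.range (fun k : Fin (d + l - 1) => Complex.exp ((Real.pi : ℂ) ^ (k : ℕ))))) :=
  fun hTH d l hdl => (PiRealGrid.ceil_le_trdeg_gridField₂_pi_pow hTH hdl).trans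
    (Literature.Barriers.Schanuel.trdeg_mono (PiRealGrid.gridField₂_le_explicit d l))

/-! ## The instance `(d, ℓ) = (4, 5)` -/

/-- **Instance `(d, ℓ) = (4, 5)` of `stub_piRealGridBound`**: under the Technical Hypothesis for
the real power tuples of `π`, `⌈20/9⌉ = 3 ≤ trdeg_ℚ ℚ(π, e, e^π, e^{π²}, …, e^{π⁷})` (so not all of
`e, e^{π²}, …, e^{π⁷}` are algebraic over Nesterenko's `ℚ(π, e^π)`).
[cite: NesterenkoPhilippon2001, Ch. 14 Thm 2.7] -/
theorem PiRealGrid.three_le_trdeg_pi_exp_pow_eight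
    (hTH : ∀ d : ℕ, Literature.Barriers.Schanuel.TechnicalHypothesis
      (fun i : Fin d => (Real.pi : ℂ) ^ (i : ℕ))) :
    ((3 : ℕ) : Cardinal) ≤ Algebra.trdeg ℚ ↥(IntermediateField.adjoin ℚ
      ({(Real.pi : ℂ)} ∪ Set.range (fun k : Fin 8 => Complex.exp ((Real.pi : ℂ) ^ (k : ℕ))))) := by
  have h := stub_piRealGridBound hTH 4 5 (by norm_num)
  norm_num at h
  exact h

end Summit.Schanuel.Schanuel.Theorems.RigidCore

end
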